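/-
Copyright (c) 2026 the pub-hodgecm-mathlib formalisation cell (harness21).  Prover seat hodgecm-mathlib-K2E4-p18 (g3), HCML Track B «K2-LIT» ∕ h413
(stmt-HodgeConjecture-24833); deal K2E3-plan (g1) 2026-09-03T23:32:58Z (b) «(H) … INDEP-from-homogeneity half», line lead K2E4-p06 (g2); RUNG 3 of the (H) line.
-/
import Summits.HodgeConjecture.HodgeConjecture.Theorems.K2E3SingularTransferSignedOfLimitFormulas      -- ★ p855452 (K2E4-p06): the frame-light imports of unit U3b
import Summits.HodgeConjecture.HodgeConjecture.Theorems.K2E3ShalikaGermHomogeneityOfUnipotentScaling   -- ★ (K2E3-p03) step (G3) at N = 3: `iterate_mem`, `eq_pow_mul_of_succ_eq_mul`; brings ★ p855276 `sum_mul_eq_single_of_dual`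
import Summits.HodgeConjecture.HodgeConjecture.Theorems.K2E4ExplicitSplitConstantPhasePair            -- ★ p855004 (K2E4-p02): `isHaarMeasure_of_ne_zero`, `stableOrbitalIntegralRel_eq_zero_of_measure_eq_zero` on `H_v`; brings ★ `isGRegular_of_isStablyConjH`
import Literature.NumberTheory.Automorphic.OrbitalIntegralLocallyConstantChart                      -- ★ `OrbitalMeasureFamily.IsCanonical.classOrbitalIntegral_mk_eq_integral_descConj`
import Literature.NumberTheory.Rogawski1990.LocalCentralizerTorusMeasureCM                          -- ★ `exists_isHaarMeasure_isInvInvariant_compactCore_eq_one` (normalised torus measure on `Z_H(γ_H)`)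
import Literature.NumberTheory.Rogawski1990.GRegularLocalisation                                    -- ★ `isLocalGRegular_of_isConj`
import HarnessLib

/-!
# K2 · E3 — `Theorems/K2E3CentralGermHomogeneityRayRefOfUnipotentScaling.lean`: ONE EXPANSION DATUM WITH A HOMOGENEOUS ELLIPTIC RAY FROM AN EQUIVARIANT
# CONTRACTION OF `H_v` THAT SCALES THE UNIPOTENT ORBITAL INTEGRALS — the central rank-one twin of ★ `K2E3ShalikaGermHomogeneityOfUnipotentScaling` (step (G3))
# (Rogawski 1990 §8.1 Prop. 8.1.1 pp. 112–113, Prop. 8.1.2 (b) p. 114; Harish-Chandra 1999 Lemma 3.2, Thm. 8.1 (1))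

HCML Track B «K2-LIT», cell `pub/hodgecm-mathlib`, crux H413 = `stmt-HodgeConjecture-24833` (lane `--supports … --as helper`); seat `hodgecm-mathlib-K2E4-p18` (g3).
Line (ii′) of unit U3b (`Cruxes/H413/Lines/K2_E3_EllipticInputsSigs_U3bCentralGerms.lean`): (H) `sig_K2E3CentralGermIndependence` ⟸ (HOM-ray) [★ p855719] ⟸
(DUAL_z) + (HOM-ray*) [★ p855760].  THIS FILE (rung 3): **(HOM-ray*) ⟸ (E) + (DUAL_z) + (Ψ-package_z)** — the `∃`-form «one expansion datum with a homogeneous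
elliptic ray» from the EXISTENCE letter (E) `sig_K2E3CentralGermExpansionExistence` (cand aea6e516723791cf, hosted ED. 3 :113), the dual-pieces letter (DUAL_z)
`sig_K2E3CentralUnipotentDualPieces` (cand f5db471200e2a663) and the cand socket (Ψ-package_z) `sig_K2E3CentralUnipotentScalingPackage` (bytes
`K2/K2E4-p18/g3/sig_K2E3CentralUnipotentScalingPackage.cand.K2E4-p18-g3.lean`): a self-map `Ψ` of `H_v` with (U1) `U₀ ∈ 𝓝 z`, (U2)∕(U2st) `U₀` saturated under
conjugacy and stable conjugacy, (E) `Ψ(xγx⁻¹) = xΨ(γ)x⁻¹`, (Z) `Z(Ψγ) = Z(γ)`, (Est)∕(I)∕(Sst) `Ψ` respects stable conjugacy, is injective on `U₀`, and every stable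
conjugate of `Ψγ` is a `Ψδ` with `δ` stably conjugate to `γ`, (C) `Ψ U₀ ⊆ U₀`, (S) `1_{U₀}·(F∘Ψ) ∈ C_c^∞`, (Q) `‖q‖ > 1`, `a u ≥ 1` off `⟦z⟧`, (RAY) a start `γs ∈ U₀`
whose `Ψ`-orbit is elliptic `G`-regular and tends to `z`, and (SC) `Φ_{mU}(u, 1_{U₀}·(F∘Ψ)) = q^{a u}·Φ_{mU}(u, F)` at the central-unipotent classes for every
admissible `mU` — in print the Cayley scaling `c ∘ (ϖ²·) ∘ c⁻¹` centred at `z` (K2E5-p12 (g0)'s road) with `q = q_v`, `a(u_reg) = 2`.  So after this file NOTHING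
but (E), (DUAL_z) and (Ψ-package_z) stands between the Cayley road and sub-letter (H).

THE MATHEMATICS (as ★ K2E3-p03's (G3), one rank lower, at a central point, with STABLE orbital integrals).  Let `(S, mU, Γ)` be the (E)-datum (STABLE expansion
`Φ^{st}(γ, fH) = Σ_u Φ_{mU}(u, fH)·Γ_u(γ)` along `𝓕 = 𝓝[elliptic G-regular] z`) and `φ_u` its dual pieces ((DUAL_z)).  (A) At `fH = φ_u` the expansion collapses:
`Φ^{st}(γ, φ_u) = Γ_u(γ)` `𝓕`-eventually.  (B) At the smooth `1_{U₀}·(φ_u∘Ψ)` it collapses through (SC): `Φ^{st}(γ, 1_{U₀}·(φ_u∘Ψ)) = q^{a u}·Γ_u(γ)` `𝓕`-eventually.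
(C) THE STABLE TRANSPORT IDENTITY `Φ^{st}(Ψγ, F) = Φ^{st}(γ, 1_{U₀}·(F∘Ψ))` for `γ ∈ U₀` with `γ`, `Ψγ` `G`-regular and the CANONICAL family `mHv`: per class it is
★ `IsCanonical.classOrbitalIntegral_mk_eq_integral_descConj` twice over `H_v ⧸ Z(δ)` (`Z(Ψδ) = Z(δ)` by (Z); the normalised torus measure ★
`exists_isHaarMeasure_isInvInvariant_compactCore_eq_one`; the integrands agree by (E) and (U2)), and `c ↦ ⟦Ψ(out c)⟧` is a bijection from the classes stably
conjugate to `γ` onto those stably conjugate to `Ψγ` ((U2st)(Est)(I)(Sst); `finsum_mem_eq_of_bijOn`); if the frame's `νHv` vanishes both sides are `0` (★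
`stableOrbitalIntegralRel_eq_zero_of_measure_eq_zero`), else `νHv` is Haar (★ `isHaarMeasure_of_ne_zero`).  (D) Along the (RAY) orbit `γ_k = Ψ^k γs → z` inside
the elliptic `G`-regular set, from some `k₀` on `γ_k` satisfies (B)'s identities and `γ_{k+1}` satisfies (A)'s, so `Γ_u(γ_{k+1}) = Φ^{st}(γ_{k+1}, φ_u) =
Φ^{st}(γ_k, 1_{U₀}·(φ_u∘Ψ)) = q^{a u}·Γ_u(γ_k)`: the geometric recursion gives (HOM-ray*) with `γseq n = γ_{n+k₀}`, `g_u = Γ_u(γ_{k₀})`, `n₀ = 0`.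

* §1 `isConj_out_mk` (generic), **`classOrbitalIntegral_mk_eq_of_contraction`** (per-class transport on `H_v`, canonical family, `νHv` Haar),
  **`stableOrbitalIntegralRel_eq_of_contraction`** (the stable transport identity (C), `νHv` only finite on compacts ∕ right invariant).
* §2 **`centralGermHomogeneityRayRef_of_unipotentScaling : ‹(E)› → ‹(DUAL_z)› → ‹(Ψ-package_z)› → ‹(HOM-ray*)›`** — THE HEAD; all three hypotheses and the conclusion
  are the cand ∕ hosted sockets VERBATIM, so U3b's next edition ties (HOM-ray*) := this ∘ (E) ∘ (DUAL_z) ∘ (Ψ-package_z) by `exact`.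

HONEST LABEL: HC_CM is proved only modulo the 7 printed citations (2 remaining named inputs: hLiu418 = stmt-HodgeConjecture-24832, h413 = stmt-HodgeConjecture-24833) until rung 0 closes.
Count-neutral helper: (HOM-ray*) becomes REL ⟸ {(E), (DUAL_z), (Ψ-package_z)} (REL ≠ ★); the three leaves OPEN.  No `sorry`, axioms ⊆ {propext, Classical.choice,
Quot.sound}, no `def`, no instance, no notation.

## References
* [Rogawski1990] J. D. Rogawski, *Automorphic Representations of Unitary Groups in Three Variables*, Ann. of Math. Stud. 123 (1990): §8.1 Prop. 8.1.1 pp. 112–113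
  (dual functions; «unique as germs»), Prop. 8.1.2 (a)(b) pp. 114–115 (descent to `Z(z) = H_v`; homogeneity along `exp(t²Y)`), (8.1.1)–(8.1.2) p. 117; §4.1
  (4.1.1) p. 39 (stable orbital integrals); §4.3 (4.3.1) p. 43 (compatible measures).
* [HarishChandra1999AdmissibleDistributions] Harish-Chandra (notes by S. DeBacker, P. J. Sally, Jr.), *Admissible Invariant Distributions on Reductive p-adic Groups*,
  AMS ULS 16 (1999): §3.1 Lemma 3.2 (homogeneity of nilpotent orbital integrals), Thm. 8.1 (1) p. 48.
* [DeitmarEchterhoff2014] A. Deitmar, S. Echterhoff, *Principles of Harmonic Analysis*, 2nd ed. (2014): Thm. 1.5.3 (the invariant quotient measure).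
-/

set_option autoImplicit false
set_option linter.dupNamespace false

noncomputable section

open Filter Topology
open MeasureTheory Measure NumberField IsDedekindDomain
open Literature.MeasureTheory.Group Literature.MeasureTheory.RestrictedProduct
open Literature.Topology.RestrictedProduct Literature.Topology.Algebra.RestrictedProduct
open Literature.NumberTheory.Rogawski1990 Literature.NumberTheory.Automorphic
open Literature.AlgebraicGeometry.ShimuraVarieties (unitaryGroup hermForm)
open scoped Matrix MatrixGroups RestrictedProduct
open scoped NNReal
open Summit.HodgeConjecture.HodgeConjecture.Cruxes.H413.K2E3ShalikaGermHomogeneityRayOfReference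
open Summit.HodgeConjecture.HodgeConjecture.Cruxes.H413.K2E3ShalikaGermHomogeneityOfUnipotentScaling

namespace Summit.HodgeConjecture.HodgeConjecture.Cruxes.H413.K2E3CentralGermHomogeneityRayRefOfUnipotentScaling

/-! ## §1 Representatives; the transport identities on `H_v` -/

/-- `γ` is conjugate to the representative `out ⟦γ⟧`. [folklore] -/
theorem isConj_out_mk {G : Type*} [Group G] (γ : G) : IsConj γ (Quotient.out (ConjClasses.mk γ)) :=
  ConjClasses.mk_eq_mk_iff_isConj.1 (Quotient.out_eq (ConjClasses.mk γ)).symm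

variable (L : Type) [Field L] [NumberField L] [IsCMField L] (v : HeightOneSpectrum (𝓞 ↥(maximalRealSubfield L)))

/-- **PER-CLASS TRANSPORT `Φ(⟦Ψδ⟧, F) = Φ(⟦δ⟧, 1_{U₀}·(F∘Ψ))`** for the CANONICAL family of a Haar measure on `H_v`, at a `G`-regular `δ ∈ U₀` with `Ψδ` `G`-regular:
both sides are `∫_{H_v ⧸ Z(δ)}` of the same integrand against the quotient of `νHv` by the normalised torus measure (`Z(Ψδ) = Z(δ)` by (Z); the integrands agree by
(E) and (U2); ★ `IsCanonical.classOrbitalIntegral_mk_eq_integral_descConj`, ★ `exists_isHaarMeasure_isInvInvariant_compactCore_eq_one`).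
[cite: Rogawski1990, §4.3 (4.3.1) p. 43; §8.1 Prop. 8.1.2 (a) p. 114] [cite: DeitmarEchterhoff2014, Thm. 1.5.3] -/
theorem classOrbitalIntegral_mk_eq_of_contraction
    [MeasurableSpace ((UnitaryGroup.cmDatum L 2 (Matrix.of fun i j : Fin 2 => if i.val + j.val + 1 = 2 then (1 : L) else 0)).Local v × (UnitaryGroup.cmDatum L 1 (Matrix.of fun i j : Fin 1 => if i.val + j.val + 1 = 1 then (1 : L) else 0)).Local v)] [BorelSpace ((UnitaryGroup.cmDatum L 2 (Matrix.of fun i j : Fin 2 => if i.val + j.val + 1 = 2 then (1 : L) else 0)).Local v × (UnitaryGroup.cmDatum L 1 (Matrix.of fun i j : Fin 1 => if i.val + j.val + 1 = 1 then (1 : L) else 0)).Local v)]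
    [∀ a : (UnitaryGroup.cmDatum L 2 (Matrix.of fun i j : Fin 2 => if i.val + j.val + 1 = 2 then (1 : L) else 0)).Local v × (UnitaryGroup.cmDatum L 1 (Matrix.of fun i j : Fin 1 => if i.val + j.val + 1 = 1 then (1 : L) else 0)).Local v,
      MeasurableSpace (((UnitaryGroup.cmDatum L 2 (Matrix.of fun i j : Fin 2 => if i.val + j.val + 1 = 2 then (1 : L) else 0)).Local v × (UnitaryGroup.cmDatum L 1 (Matrix.of fun i j : Fin 1 => if i.val + j.val + 1 = 1 then (1 : L) else 0)).Local v) ⧸ Subgroup.centralizer ({a} : Set ((UnitaryGroup.cmDatum L 2 (Matrix.of fun i j : Fin 2 => if i.val + j.val + 1 = 2 then (1 : L) else 0)).Local v × (UnitaryGroup.cmDatum L 1 (Matrix.of fun i j : Fin 1 => if i.val + j.val + 1 = 1 then (1 : L) else 0)).Local v)))]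
    [∀ a : (UnitaryGroup.cmDatum L 2 (Matrix.of fun i j : Fin 2 => if i.val + j.val + 1 = 2 then (1 : L) else 0)).Local v × (UnitaryGroup.cmDatum L 1 (Matrix.of fun i j : Fin 1 => if i.val + j.val + 1 = 1 then (1 : L) else 0)).Local v,
      BorelSpace (((UnitaryGroup.cmDatum L 2 (Matrix.of fun i j : Fin 2 => if i.val + j.val + 1 = 2 then (1 : L) else 0)).Local v × (UnitaryGroup.cmDatum L 1 (Matrix.of fun i j : Fin 1 => if i.val + j.val + 1 = 1 then (1 : L) else 0)).Local v) ⧸ Subgroup.centralizer ({a} : Set ((UnitaryGroup.cmDatum L 2 (Matrix.of fun i j : Fin 2 => if i.val + j.val + 1 = 2 then (1 : L) else 0)).Local v × (UnitaryGroup.cmDatum L 1 (Matrix.of fun i j : Fin 1 => if i.val + j.val + 1 = 1 then (1 : L) else 0)).Local v)))]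
    (νHv : Measure ((UnitaryGroup.cmDatum L 2 (Matrix.of fun i j : Fin 2 => if i.val + j.val + 1 = 2 then (1 : L) else 0)).Local v × (UnitaryGroup.cmDatum L 1 (Matrix.of fun i j : Fin 1 => if i.val + j.val + 1 = 1 then (1 : L) else 0)).Local v)) [νHv.IsHaarMeasure] [νHv.IsMulRightInvariant]
    {mHv : OrbitalMeasureFamily ((UnitaryGroup.cmDatum L 2 (Matrix.of fun i j : Fin 2 => if i.val + j.val + 1 = 2 then (1 : L) else 0)).Local v × (UnitaryGroup.cmDatum L 1 (Matrix.of fun i j : Fin 1 => if i.val + j.val + 1 = 1 then (1 : L) else 0)).Local v)} (hcan : mHv.IsCanonical (IsLocalGRegular L v) νHv)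
    {Ψ : (UnitaryGroup.cmDatum L 2 (Matrix.of fun i j : Fin 2 => if i.val + j.val + 1 = 2 then (1 : L) else 0)).Local v × (UnitaryGroup.cmDatum L 1 (Matrix.of fun i j : Fin 1 => if i.val + j.val + 1 = 1 then (1 : L) else 0)).Local v → (UnitaryGroup.cmDatum L 2 (Matrix.of fun i j : Fin 2 => if i.val + j.val + 1 = 2 then (1 : L) else 0)).Local v × (UnitaryGroup.cmDatum L 1 (Matrix.of fun i j : Fin 1 => if i.val + j.val + 1 = 1 then (1 : L) else 0)).Local v} {U₀ : Set ((UnitaryGroup.cmDatum L 2 (Matrix.of fun i j : Fin 2 => if i.val + j.val + 1 = 2 then (1 : L) else 0)).Local v × (UnitaryGroup.cmDatum L 1 (Matrix.of fun i j : Fin 1 => if i.val + j.val + 1 = 1 then (1 : L) else 0)).Local v)}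
    (hU2 : ∀ γ ∈ U₀, ∀ x : (UnitaryGroup.cmDatum L 2 (Matrix.of fun i j : Fin 2 => if i.val + j.val + 1 = 2 then (1 : L) else 0)).Local v × (UnitaryGroup.cmDatum L 1 (Matrix.of fun i j : Fin 1 => if i.val + j.val + 1 = 1 then (1 : L) else 0)).Local v, x * γ * x⁻¹ ∈ U₀)
    (hE : ∀ γ ∈ U₀, ∀ x : (UnitaryGroup.cmDatum L 2 (Matrix.of fun i j : Fin 2 => if i.val + j.val + 1 = 2 then (1 : L) else 0)).Local v × (UnitaryGroup.cmDatum L 1 (Matrix.of fun i j : Fin 1 => if i.val + j.val + 1 = 1 then (1 : L) else 0)).Local v, Ψ (x * γ * x⁻¹) = x * Ψ γ * x⁻¹)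
    (hZ : ∀ γ ∈ U₀, ∀ y : (UnitaryGroup.cmDatum L 2 (Matrix.of fun i j : Fin 2 => if i.val + j.val + 1 = 2 then (1 : L) else 0)).Local v × (UnitaryGroup.cmDatum L 1 (Matrix.of fun i j : Fin 1 => if i.val + j.val + 1 = 1 then (1 : L) else 0)).Local v, y * γ = γ * y ↔ y * Ψ γ = Ψ γ * y)
    {δ : (UnitaryGroup.cmDatum L 2 (Matrix.of fun i j : Fin 2 => if i.val + j.val + 1 = 2 then (1 : L) else 0)).Local v × (UnitaryGroup.cmDatum L 1 (Matrix.of fun i j : Fin 1 => if i.val + j.val + 1 = 1 then (1 : L) else 0)).Local v} (hδU : δ ∈ U₀) (hδ : IsLocalGRegular L v δ) (hΨδ : IsLocalGRegular L v (Ψ δ)) (F : (UnitaryGroup.cmDatum L 2 (Matrix.of fun i j : Fin 2 => if i.val + j.val + 1 = 2 then (1 : L) else 0)).Local v × (UnitaryGroup.cmDatum L 1 (Matrix.of fun i j : Fin 1 => if i.val + j.val + 1 = 1 then (1 : L) else 0)).Local v → ℂ) :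
    classOrbitalIntegral mHv F (ConjClasses.mk (Ψ δ)) = classOrbitalIntegral mHv (U₀.indicator (F ∘ Ψ)) (ConjClasses.mk δ) := by
  obtain ⟨hTc, ρ, hρH, hρI, hρ1⟩ := exists_isHaarMeasure_isInvInvariant_compactCore_eq_one L v δ hδ
  haveI := hρH
  haveI := hρI
  have hP : ∀ g x : (UnitaryGroup.cmDatum L 2 (Matrix.of fun i j : Fin 2 => if i.val + j.val + 1 = 2 then (1 : L) else 0)).Local v × (UnitaryGroup.cmDatum L 1 (Matrix.of fun i j : Fin 1 => if i.val + j.val + 1 = 1 then (1 : L) else 0)).Local v, IsLocalGRegular L v g → IsLocalGRegular L v (x * g * x⁻¹) :=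
    fun g x hg => isLocalGRegular_of_isConj (isConj_iff.2 ⟨x, rfl⟩) hg
  have hTt : ∀ τ ∈ Subgroup.centralizer ({δ} : Set ((UnitaryGroup.cmDatum L 2 (Matrix.of fun i j : Fin 2 => if i.val + j.val + 1 = 2 then (1 : L) else 0)).Local v × (UnitaryGroup.cmDatum L 1 (Matrix.of fun i j : Fin 1 => if i.val + j.val + 1 = 1 then (1 : L) else 0)).Local v)), τ * δ = δ * τ :=
    fun τ hτ => Subgroup.mem_centralizer_singleton_iff.1 hτ
  have hTΨ : Subgroup.centralizer ({Ψ δ} : Set ((UnitaryGroup.cmDatum L 2 (Matrix.of fun i j : Fin 2 => if i.val + j.val + 1 = 2 then (1 : L) else 0)).Local v × (UnitaryGroup.cmDatum L 1 (Matrix.of fun i j : Fin 1 => if i.val + j.val + 1 = 1 then (1 : L) else 0)).Local v)) = Subgroup.centralizer ({δ} : Set ((UnitaryGroup.cmDatum L 2 (Matrix.of fun i j : Fin 2 => if i.val + j.val + 1 = 2 then (1 : L) else 0)).Local v × (UnitaryGroup.cmDatum L 1 (Matrix.of fun i j : Fin 1 => if i.val + j.val + 1 = 1 then (1 : L) else 0)).Local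 v)) := by
    ext y
    rw [Subgroup.mem_centralizer_singleton_iff, Subgroup.mem_centralizer_singleton_iff]
    exact (hZ δ hδU y).symm
  have hTtΨ : ∀ τ ∈ Subgroup.centralizer ({δ} : Set ((UnitaryGroup.cmDatum L 2 (Matrix.of fun i j : Fin 2 => if i.val + j.val + 1 = 2 then (1 : L) else 0)).Local v × (UnitaryGroup.cmDatum L 1 (Matrix.of fun i j : Fin 1 => if i.val + j.val + 1 = 1 then (1 : L) else 0)).Local v)), τ * Ψ δ = Ψ δ * τ :=
    fun τ hτ => (hZ δ hδU τ).1 (hTt τ hτ)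
  rw [hcan.classOrbitalIntegral_mk_eq_integral_descConj hP hΨδ (Subgroup.centralizer ({δ} : Set ((UnitaryGroup.cmDatum L 2 (Matrix.of fun i j : Fin 2 => if i.val + j.val + 1 = 2 then (1 : L) else 0)).Local v × (UnitaryGroup.cmDatum L 1 (Matrix.of fun i j : Fin 1 => if i.val + j.val + 1 = 1 then (1 : L) else 0)).Local v))) hTc hTΨ hTtΨ ρ hρ1 F,
    hcan.classOrbitalIntegral_mk_eq_integral_descConj hP hδ (Subgroup.centralizer ({δ} : Set ((UnitaryGroup.cmDatum L 2 (Matrix.of fun i j : Fin 2 => if i.val + j.val + 1 = 2 then (1 : L) else 0)).Local v × (UnitaryGroup.cmDatum L 1 (Matrix.of fun i j : Fin 1 => if i.val + j.val + 1 = 1 then (1 : L) else 0)).Local v))) hTc rfl hTt ρ hρ1 (U₀.indicator (F ∘ Ψ))]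
  refine integral_congr_ae (Eventually.of_forall fun y => ?_)
  induction y using QuotientGroup.induction_on with
  | H x => rw [descConj_mk, descConj_mk, Set.indicator_of_mem (hU2 δ hδU x), Function.comp_apply, hE δ hδU x]

/-- **THE STABLE TRANSPORT IDENTITY `Φ^{st}(Ψγ, F) = Φ^{st}(γ, 1_{U₀}·(F∘Ψ))`** for the canonical family `mHv` (frame measure `νHv` finite on compacts, right invariant)
at a `G`-regular `γ ∈ U₀` with `Ψγ` `G`-regular: the per-class transport summed over the classes stably conjugate to `γ`, matched with those stably conjugate to `Ψγ`
by the bijection `c ↦ ⟦Ψ(out c)⟧` ((U2st)(Est)(I)(Sst); stable conjugates of `G`-regular elements are `G`-regular, ★ `isGRegular_of_isStablyConjH`); `νHv = 0` makes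
both sides vanish. [cite: Rogawski1990, §4.1 (4.1.1) p. 39; §4.3 (4.3.1) p. 43; §8.1 Prop. 8.1.2 (a) p. 114] [cite: DeitmarEchterhoff2014, Thm. 1.5.3] -/
theorem stableOrbitalIntegralRel_eq_of_contraction
    [MeasurableSpace ((UnitaryGroup.cmDatum L 2 (Matrix.of fun i j : Fin 2 => if i.val + j.val + 1 = 2 then (1 : L) else 0)).Local v × (UnitaryGroup.cmDatum L 1 (Matrix.of fun i j : Fin 1 => if i.val + j.val + 1 = 1 then (1 : L) else 0)).Local v)] [BorelSpace ((UnitaryGroup.cmDatum L 2 (Matrix.of fun i j : Fin 2 => if i.val + j.val + 1 = 2 then (1 : L) else 0)).Local v × (UnitaryGroup.cmDatum L 1 (Matrix.of fun i j : Fin 1 => if i.val + j.val + 1 = 1 then (1 : L) else 0)).Local v)]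
    [∀ a : (UnitaryGroup.cmDatum L 2 (Matrix.of fun i j : Fin 2 => if i.val + j.val + 1 = 2 then (1 : L) else 0)).Local v × (UnitaryGroup.cmDatum L 1 (Matrix.of fun i j : Fin 1 => if i.val + j.val + 1 = 1 then (1 : L) else 0)).Local v,
      MeasurableSpace (((UnitaryGroup.cmDatum L 2 (Matrix.of fun i j : Fin 2 => if i.val + j.val + 1 = 2 then (1 : L) else 0)).Local v × (UnitaryGroup.cmDatum L 1 (Matrix.of fun i j : Fin 1 => if i.val + j.val + 1 = 1 then (1 : L) else 0)).Local v) ⧸ Subgroup.centralizer ({a} : Set ((UnitaryGroup.cmDatum L 2 (Matrix.of fun i j : Fin 2 => if i.val + j.val + 1 = 2 then (1 : L) else 0)).Local v × (UnitaryGroup.cmDatum L 1 (Matrix.of fun i j : Fin 1 => if i.val + j.val + 1 = 1 then (1 : L) else 0)).Local v)))]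
    [∀ a : (UnitaryGroup.cmDatum L 2 (Matrix.of fun i j : Fin 2 => if i.val + j.val + 1 = 2 then (1 : L) else 0)).Local v × (UnitaryGroup.cmDatum L 1 (Matrix.of fun i j : Fin 1 => if i.val + j.val + 1 = 1 then (1 : L) else 0)).Local v,
      BorelSpace (((UnitaryGroup.cmDatum L 2 (Matrix.of fun i j : Fin 2 => if i.val + j.val + 1 = 2 then (1 : L) else 0)).Local v × (UnitaryGroup.cmDatum L 1 (Matrix.of fun i j : Fin 1 => if i.val + j.val + 1 = 1 then (1 : L) else 0)).Local v) ⧸ Subgroup.centralizer ({a} : Set ((UnitaryGroup.cmDatum L 2 (Matrix.of fun i j : Fin 2 => if i.val + j.val + 1 = 2 then (1 : L) else 0)).Local v × (UnitaryGroup.cmDatum L 1 (Matrix.of fun i j : Fin 1 => if i.val + j.val + 1 = 1 then (1 : L) else 0)).Local v)))]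
    (νHv : Measure ((UnitaryGroup.cmDatum L 2 (Matrix.of fun i j : Fin 2 => if i.val + j.val + 1 = 2 then (1 : L) else 0)).Local v × (UnitaryGroup.cmDatum L 1 (Matrix.of fun i j : Fin 1 => if i.val + j.val + 1 = 1 then (1 : L) else 0)).Local v)) [IsFiniteMeasureOnCompacts νHv] [νHv.IsMulRightInvariant]
    {mHv : OrbitalMeasureFamily ((UnitaryGroup.cmDatum L 2 (Matrix.of fun i j : Fin 2 => if i.val + j.val + 1 = 2 then (1 : L) else 0)).Local v × (UnitaryGroup.cmDatum L 1 (Matrix.of fun i j : Fin 1 => if i.val + j.val + 1 = 1 then (1 : L) else 0)).Local v)} (hcan : mHv.IsCanonical (IsLocalGRegular L v) νHv)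
    {Ψ : (UnitaryGroup.cmDatum L 2 (Matrix.of fun i j : Fin 2 => if i.val + j.val + 1 = 2 then (1 : L) else 0)).Local v × (UnitaryGroup.cmDatum L 1 (Matrix.of fun i j : Fin 1 => if i.val + j.val + 1 = 1 then (1 : L) else 0)).Local v → (UnitaryGroup.cmDatum L 2 (Matrix.of fun i j : Fin 2 => if i.val + j.val + 1 = 2 then (1 : L) else 0)).Local v × (UnitaryGroup.cmDatum L 1 (Matrix.of fun i j : Fin 1 => if i.val + j.val + 1 = 1 then (1 : L) else 0)).Local v} {U₀ : Set ((UnitaryGroup.cmDatum L 2 (Matrix.of fun i j : Fin 2 => if i.val + j.val + 1 = 2 then (1 : L) else 0)).Local v × (UnitaryGroup.cmDatum L 1 (Matrix.of fun i j : Fin 1 => if i.val + j.val + 1 = 1 then (1 : L) else 0)).Local v)}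
    (hU2 : ∀ γ ∈ U₀, ∀ x : (UnitaryGroup.cmDatum L 2 (Matrix.of fun i j : Fin 2 => if i.val + j.val + 1 = 2 then (1 : L) else 0)).Local v × (UnitaryGroup.cmDatum L 1 (Matrix.of fun i j : Fin 1 => if i.val + j.val + 1 = 1 then (1 : L) else 0)).Local v, x * γ * x⁻¹ ∈ U₀)
    (hU2st : ∀ γ ∈ U₀, ∀ δ : (UnitaryGroup.cmDatum L 2 (Matrix.of fun i j : Fin 2 => if i.val + j.val + 1 = 2 then (1 : L) else 0)).Local v × (UnitaryGroup.cmDatum L 1 (Matrix.of fun i j : Fin 1 => if i.val + j.val + 1 = 1 then (1 : L) else 0)).Local v, IsLocalStablyConjH L v γ δ → δ ∈ U₀)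
    (hE : ∀ γ ∈ U₀, ∀ x : (UnitaryGroup.cmDatum L 2 (Matrix.of fun i j : Fin 2 => if i.val + j.val + 1 = 2 then (1 : L) else 0)).Local v × (UnitaryGroup.cmDatum L 1 (Matrix.of fun i j : Fin 1 => if i.val + j.val + 1 = 1 then (1 : L) else 0)).Local v, Ψ (x * γ * x⁻¹) = x * Ψ γ * x⁻¹)
    (hZ : ∀ γ ∈ U₀, ∀ y : (UnitaryGroup.cmDatum L 2 (Matrix.of fun i j : Fin 2 => if i.val + j.val + 1 = 2 then (1 : L) else 0)).Local v × (UnitaryGroup.cmDatum L 1 (Matrix.of fun i j : Fin 1 => if i.val + j.val + 1 = 1 then (1 : L) else 0)).Local v, y * γ = γ * y ↔ y * Ψ γ = Ψ γ * y)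
    (hEst : ∀ γ ∈ U₀, ∀ δ ∈ U₀, IsLocalStablyConjH L v γ δ → IsLocalStablyConjH L v (Ψ γ) (Ψ δ))
    (hI : ∀ γ ∈ U₀, ∀ δ ∈ U₀, Ψ γ = Ψ δ → γ = δ)
    (hSst : ∀ γ ∈ U₀, ∀ η : (UnitaryGroup.cmDatum L 2 (Matrix.of fun i j : Fin 2 => if i.val + j.val + 1 = 2 then (1 : L) else 0)).Local v × (UnitaryGroup.cmDatum L 1 (Matrix.of fun i j : Fin 1 => if i.val + j.val + 1 = 1 then (1 : L) else 0)).Local v, IsLocalStablyConjH L v (Ψ γ) η → ∃ δ ∈ U₀, IsLocalStablyConjH L v γ δ ∧ Ψ δ = η)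
    {γ : (UnitaryGroup.cmDatum L 2 (Matrix.of fun i j : Fin 2 => if i.val + j.val + 1 = 2 then (1 : L) else 0)).Local v × (UnitaryGroup.cmDatum L 1 (Matrix.of fun i j : Fin 1 => if i.val + j.val + 1 = 1 then (1 : L) else 0)).Local v} (hγU : γ ∈ U₀) (hγ : IsLocalGRegular L v γ) (hΨγ : IsLocalGRegular L v (Ψ γ)) (F : (UnitaryGroup.cmDatum L 2 (Matrix.of fun i j : Fin 2 => if i.val + j.val + 1 = 2 then (1 : L) else 0)).Local v × (UnitaryGroup.cmDatum L 1 (Matrix.of fun i j : Fin 1 => if i.val + j.val + 1 = 1 then (1 : L) else 0)).Local v → ℂ) :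
    stableOrbitalIntegralRel (IsLocalStablyConjH L v) mHv F (Ψ γ) =
      stableOrbitalIntegralRel (IsLocalStablyConjH L v) mHv (U₀.indicator (F ∘ Ψ)) γ := by
  classical
  by_cases hν : νHv = 0
  · rw [K2E4ExplicitSplitConstantPhase.stableOrbitalIntegralRel_eq_zero_of_measure_eq_zero L v νHv mHv hcan hν F hΨγ,
      K2E4ExplicitSplitConstantPhase.stableOrbitalIntegralRel_eq_zero_of_measure_eq_zero L v νHv mHv hcan hν (U₀.indicator (F ∘ Ψ)) hγ]
  haveI : νHv.IsHaarMeasure := K2E4ExplicitSplitConstantPhase.isHaarMeasure_of_ne_zero L v νHv hν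
  rw [stableOrbitalIntegralRel_def, stableOrbitalIntegralRel_def]
  symm
  refine finsum_mem_eq_of_bijOn (fun c => ConjClasses.mk (Ψ (Quotient.out c))) ⟨?_, ?_, ?_⟩ ?_
  · -- maps the classes stably conjugate to `γ` to classes stably conjugate to `Ψ γ`
    intro c hc
    simp only [Set.mem_setOf_eq] at hc ⊢
    have hcU : Quotient.out c ∈ U₀ := hU2st γ hγU _ hc
    exact IsStablyConjH.trans (hEst γ hγU _ hcU hc) (isStablyConjH_of_isConj (isConj_out_mk (Ψ (Quotient.out c))))
  · -- injective there
    intro c₁ hc₁ c₂ hc₂ heq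
    simp only [Set.mem_setOf_eq] at hc₁ hc₂
    have hc₁U : Quotient.out c₁ ∈ U₀ := hU2st γ hγU _ hc₁
    have hc₂U : Quotient.out c₂ ∈ U₀ := hU2st γ hγU _ hc₂
    obtain ⟨x, hx⟩ := isConj_iff.1 (ConjClasses.mk_eq_mk_iff_isConj.1 heq)
    have hx' : x * Quotient.out c₁ * x⁻¹ = Quotient.out c₂ :=
      hI _ (hU2 _ hc₁U x) _ hc₂U (by rw [hE _ hc₁U x, hx])
    calc c₁ = ConjClasses.mk (Quotient.out c₁) := (Quotient.out_eq c₁).symm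
      _ = ConjClasses.mk (Quotient.out c₂) := ConjClasses.mk_eq_mk_iff_isConj.2 (isConj_iff.2 ⟨x, hx'⟩)
      _ = c₂ := Quotient.out_eq c₂
  · -- onto the classes stably conjugate to `Ψ γ`
    intro c' hc'
    simp only [Set.mem_setOf_eq] at hc'
    obtain ⟨δ, hδU, hst, hΨδ⟩ := hSst γ hγU (Quotient.out c') hc'
    obtain ⟨y, hy⟩ := isConj_iff.1 (isConj_out_mk δ)
    refine ⟨ConjClasses.mk δ, ?_, ?_⟩
    · simp only [Set.mem_setOf_eq]
      exact IsStablyConjH.trans hst (isStablyConjH_of_isConj (isConj_out_mk δ))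
    · show ConjClasses.mk (Ψ (Quotient.out (ConjClasses.mk δ))) = c'
      rw [← hy, hE δ hδU y, hΨδ]
      calc ConjClasses.mk (y * Quotient.out c' * y⁻¹) = ConjClasses.mk (Quotient.out c') :=
            (ConjClasses.mk_eq_mk_iff_isConj.2 (isConj_iff.2 ⟨y, rfl⟩)).symm
        _ = c' := Quotient.out_eq c'
  · -- the summands agree: the per-class transport at `δ = out c`
    intro c hc
    simp only [Set.mem_setOf_eq] at hc
    have hcU : Quotient.out c ∈ U₀ := hU2st γ hγU _ hc
    have hcreg : IsLocalGRegular L v (Quotient.out c) := isGRegular_of_isStablyConjH _ _ _ _ hc hγ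
    have hΨcreg : IsLocalGRegular L v (Ψ (Quotient.out c)) := isGRegular_of_isStablyConjH _ _ _ _ (hEst γ hγU _ hcU hc) hΨγ
    show classOrbitalIntegral mHv (U₀.indicator (F ∘ Ψ)) c = classOrbitalIntegral mHv F (ConjClasses.mk (Ψ (Quotient.out c)))
    rw [classOrbitalIntegral_mk_eq_of_contraction L v νHv hcan hU2 hE hZ hcU hcreg hΨcreg F]
    conv_lhs => rw [← Quotient.out_eq c]
    rfl

/-! ## §2 The head: (HOM-ray*) from (E), (DUAL_z) and (Ψ-package_z), token for token -/

/-- **(HOM-ray*) ⟸ (E) + (DUAL_z) + (Ψ-package_z): ONE CENTRAL EXPANSION DATUM WITH A HOMOGENEOUS ELLIPTIC RAY from an equivariant contraction of `H_v` that scales the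
unipotent orbital integrals.**  Hypotheses = (E) `…U3bCentralGerms.sig_K2E3CentralGermExpansionExistence` (aea6e516723791cf), (DUAL_z)
`…U3bCentralGerms.sig_K2E3CentralUnipotentDualPieces` (f5db471200e2a663) and (Ψ-package_z) `…U3bCentralGerms.sig_K2E3CentralUnipotentScalingPackage` VERBATIM;
conclusion = (HOM-ray*) `…U3bCentralGerms.sig_K2E3CentralGermHomogeneityRayRef` (4f34a3611dec5133) VERBATIM.  Proof: (A)(B)(C)(D) of the module docstring.
[cite: Rogawski1990, §8.1 Prop. 8.1.1 pp. 112–113; Prop. 8.1.2 (b) p. 114] [cite: HarishChandra1999AdmissibleDistributions, §3.1 Lemma 3.2; Thm. 8.1 p. 48]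
[cite: DeitmarEchterhoff2014, Thm. 1.5.3] -/
theorem centralGermHomogeneityRayRef_of_unipotentScaling
    (hExp :
    ∀ (L : Type) [Field L] [NumberField L] [IsCMField L] (H' : Matrix (Fin 3) (Fin 3) L),
      (H'.map (cmConjRingHom L)).transpose = H' →
      (∀ x : Fin 3 → L, hermForm (cmConjRingHom L) H' x x = 0 → x = 0) →
    ∀ (v : HeightOneSpectrum (𝓞 ↥(maximalRealSubfield L)))
      [MeasurableSpace ((UnitaryGroup.cmDatum L 2 (Matrix.of fun i j : Fin 2 => if i.val + j.val + 1 = 2 then (1 : L) else 0)).Local v × (UnitaryGroup.cmDatum L 1 (Matrix.of fun i j : Fin 1 => if i.val + j.val + 1 = 1 then (1 : L) else 0)).Local v)] [BorelSpace ((UnitaryGroup.cmDatum L 2 (Matrix.of fun i j : Fin 2 => if i.val + j.val + 1 = 2 then (1 : L) else 0)).Local v × (UnitaryGroup.cmDatum L 1 (Matrix.of fun i j : Fin 1 => if i.val + j.val + 1 = 1 then (1 : L) else 0)).Local v)]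
      [∀ a : (UnitaryGroup.cmDatum L 2 (Matrix.of fun i j : Fin 2 => if i.val + j.val + 1 = 2 then (1 : L) else 0)).Local v × (UnitaryGroup.cmDatum L 1 (Matrix.of fun i j : Fin 1 => if i.val + j.val + 1 = 1 then (1 : L) else 0)).Local v,
        MeasurableSpace (((UnitaryGroup.cmDatum L 2 (Matrix.of fun i j : Fin 2 => if i.val + j.val + 1 = 2 then (1 : L) else 0)).Local v × (UnitaryGroup.cmDatum L 1 (Matrix.of fun i j : Fin 1 => if i.val + j.val + 1 = 1 then (1 : L) else 0)).Local v) ⧸ Subgroup.centralizer ({a} : Set ((UnitaryGroup.cmDatum L 2 (Matrix.of fun i j : Fin 2 => if i.val + j.val + 1 = 2 then (1 : L) else 0)).Local v × (UnitaryGroup.cmDatum L 1 (Matrix.of fun i j : Fin 1 => if i.val + j.val + 1 = 1 then (1 : L) else 0)).Local v)))]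
      [∀ a : (UnitaryGroup.cmDatum L 2 (Matrix.of fun i j : Fin 2 => if i.val + j.val + 1 = 2 then (1 : L) else 0)).Local v × (UnitaryGroup.cmDatum L 1 (Matrix.of fun i j : Fin 1 => if i.val + j.val + 1 = 1 then (1 : L) else 0)).Local v,
        BorelSpace (((UnitaryGroup.cmDatum L 2 (Matrix.of fun i j : Fin 2 => if i.val + j.val + 1 = 2 then (1 : L) else 0)).Local v × (UnitaryGroup.cmDatum L 1 (Matrix.of fun i j : Fin 1 => if i.val + j.val + 1 = 1 then (1 : L) else 0)).Local v) ⧸ Subgroup.centralizer ({a} : Set ((UnitaryGroup.cmDatum L 2 (Matrix.of fun i j : Fin 2 => if i.val + j.val + 1 = 2 then (1 : L) else 0)).Local v × (UnitaryGroup.cmDatum L 1 (Matrix.of fun i j : Fin 1 => if i.val + j.val + 1 = 1 then (1 : L) else 0)).Local v)))]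
      [MeasurableSpace ((UnitaryGroup.cmDatum L 3 H').Local v)] [BorelSpace ((UnitaryGroup.cmDatum L 3 H').Local v)]
      [∀ γ : (UnitaryGroup.cmDatum L 3 H').Local v, MeasurableSpace ((UnitaryGroup.cmDatum L 3 H').Local v ⧸ Subgroup.centralizer ({γ} : Set ((UnitaryGroup.cmDatum L 3 H').Local v)))]
      [∀ γ : (UnitaryGroup.cmDatum L 3 H').Local v, BorelSpace ((UnitaryGroup.cmDatum L 3 H').Local v ⧸ Subgroup.centralizer ({γ} : Set ((UnitaryGroup.cmDatum L 3 H').Local v)))]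
      (νHv : Measure ((UnitaryGroup.cmDatum L 2 (Matrix.of fun i j : Fin 2 => if i.val + j.val + 1 = 2 then (1 : L) else 0)).Local v × (UnitaryGroup.cmDatum L 1 (Matrix.of fun i j : Fin 1 => if i.val + j.val + 1 = 1 then (1 : L) else 0)).Local v)) (νGv : Measure ((UnitaryGroup.cmDatum L 3 H').Local v))
      [IsFiniteMeasureOnCompacts νHv] [νHv.IsMulRightInvariant] [νGv.IsHaarMeasure] [νGv.IsMulRightInvariant]
      (Δv : LocalTransferFactor L H' v)
      (mHv : OrbitalMeasureFamily ((UnitaryGroup.cmDatum L 2 (Matrix.of fun i j : Fin 2 => if i.val + j.val + 1 = 2 then (1 : L) else 0)).Local v × (UnitaryGroup.cmDatum L 1 (Matrix.of fun i j : Fin 1 => if i.val + j.val + 1 = 1 then (1 : L) else 0)).Local v)) (mGv : OrbitalMeasureFamily ((UnitaryGroup.cmDatum L 3 H').Local v)),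
      IsLocalTransferDatum L H' v Δv mHv mGv →
      mHv.IsCanonical (IsLocalGRegular L v) νHv →
      mGv.IsCanonical (fun γ : (UnitaryGroup.cmDatum L 3 H').Local v => IsRegularElt (γ.val : GL (Fin 3) (UnitaryGroup.LocalRing L v))) νGv →
      Subsingleton (UnitaryGroup.PlacesOver L v) →
    ∀ z : (UnitaryGroup.cmDatum L 2 (Matrix.of fun i j : Fin 2 => if i.val + j.val + 1 = 2 then (1 : L) else 0)).Local v × (UnitaryGroup.cmDatum L 1 (Matrix.of fun i j : Fin 1 => if i.val + j.val + 1 = 1 then (1 : L) else 0)).Local v, z ∈ Subgroup.center ((UnitaryGroup.cmDatum L 2 (Matrix.of fun i j : Fin 2 => if i.val + j.val + 1 = 2 then (1 : L) else 0)).Local v × (UnitaryGroup.cmDatum L 1 (Matrix.of fun i j : Fin 1 => if i.val + j.val + 1 = 1 then (1 : L) else 0)).Local v) →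
    ∃ (S : Finset (ConjClasses ((UnitaryGroup.cmDatum L 2 (Matrix.of fun i j : Fin 2 => if i.val + j.val + 1 = 2 then (1 : L) else 0)).Local v × (UnitaryGroup.cmDatum L 1 (Matrix.of fun i j : Fin 1 => if i.val + j.val + 1 = 1 then (1 : L) else 0)).Local v))) (mU : OrbitalMeasureFamily ((UnitaryGroup.cmDatum L 2 (Matrix.of fun i j : Fin 2 => if i.val + j.val + 1 = 2 then (1 : L) else 0)).Local v × (UnitaryGroup.cmDatum L 1 (Matrix.of fun i j : Fin 1 => if i.val + j.val + 1 = 1 then (1 : L) else 0)).Local v))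
      (Γ : ConjClasses ((UnitaryGroup.cmDatum L 2 (Matrix.of fun i j : Fin 2 => if i.val + j.val + 1 = 2 then (1 : L) else 0)).Local v × (UnitaryGroup.cmDatum L 1 (Matrix.of fun i j : Fin 1 => if i.val + j.val + 1 = 1 then (1 : L) else 0)).Local v) → (UnitaryGroup.cmDatum L 2 (Matrix.of fun i j : Fin 2 => if i.val + j.val + 1 = 2 then (1 : L) else 0)).Local v × (UnitaryGroup.cmDatum L 1 (Matrix.of fun i j : Fin 1 => if i.val + j.val + 1 = 1 then (1 : L) else 0)).Local v → ℂ),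
      ConjClasses.mk z ∈ S ∧
      (∀ u ∈ S, ((((Quotient.out u * z⁻¹).1).val : GL (Fin 2) (UnitaryGroup.LocalRing L v)).val - 1) ^ 2 = 0 ∧ (Quotient.out u * z⁻¹).2 = 1) ∧
      mU.IsAdmissibleOn (fun γ : (UnitaryGroup.cmDatum L 2 (Matrix.of fun i j : Fin 2 => if i.val + j.val + 1 = 2 then (1 : L) else 0)).Local v × (UnitaryGroup.cmDatum L 1 (Matrix.of fun i j : Fin 1 => if i.val + j.val + 1 = 1 then (1 : L) else 0)).Local v => ConjClasses.mk γ ∈ S) ∧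
      (∀ u ∈ S, ∀ fH : (UnitaryGroup.cmDatum L 2 (Matrix.of fun i j : Fin 2 => if i.val + j.val + 1 = 2 then (1 : L) else 0)).Local v × (UnitaryGroup.cmDatum L 1 (Matrix.of fun i j : Fin 1 => if i.val + j.val + 1 = 1 then (1 : L) else 0)).Local v → ℂ, IsLocSmooth fH →
        Integrable (descConj (Quotient.out u : (UnitaryGroup.cmDatum L 2 (Matrix.of fun i j : Fin 2 => if i.val + j.val + 1 = 2 then (1 : L) else 0)).Local v × (UnitaryGroup.cmDatum L 1 (Matrix.of fun i j : Fin 1 => if i.val + j.val + 1 = 1 then (1 : L) else 0)).Local v) (Subgroup.centralizer ({(Quotient.out u : (UnitaryGroup.cmDatum L 2 (Matrix.of fun i j : Fin 2 => if i.val + j.val + 1 = 2 then (1 : L) else 0)).Local v × (UnitaryGroup.cmDatum L 1 (Matrix.of fun i j : Fin 1 => if i.val + j.val + 1 = 1 then (1 : L) else 0)).Local v)} : Set ((UnitaryGroup.cmDatum L 2 (Matrix.of fun i j : Fin 2 => if i.val + j.val + 1 = 2 then (1 : L) else 0)).Local v × (UnitaryGroup.cmDatum L 1 (Matrix.of fun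 i j : Fin 1 => if i.val + j.val + 1 = 1 then (1 : L) else 0)).Local v)))
          (fun _ hg => Subgroup.mem_centralizer_singleton_iff.1 hg) fH) (mU u)) ∧
      (∀ fH : (UnitaryGroup.cmDatum L 2 (Matrix.of fun i j : Fin 2 => if i.val + j.val + 1 = 2 then (1 : L) else 0)).Local v × (UnitaryGroup.cmDatum L 1 (Matrix.of fun i j : Fin 1 => if i.val + j.val + 1 = 1 then (1 : L) else 0)).Local v → ℂ, IsLocSmooth fH → ∀ᶠ γ in 𝓝[{γ : (UnitaryGroup.cmDatum L 2 (Matrix.of fun i j : Fin 2 => if i.val + j.val + 1 = 2 then (1 : L) else 0)).Local v × (UnitaryGroup.cmDatum L 1 (Matrix.of fun i j : Fin 1 => if i.val + j.val + 1 = 1 then (1 : L) else 0)).Local v |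
            IsLocalGRegular L v γ ∧ CompactSpace (Subgroup.centralizer ({γ} : Set ((UnitaryGroup.cmDatum L 2 (Matrix.of fun i j : Fin 2 => if i.val + j.val + 1 = 2 then (1 : L) else 0)).Local v × (UnitaryGroup.cmDatum L 1 (Matrix.of fun i j : Fin 1 => if i.val + j.val + 1 = 1 then (1 : L) else 0)).Local v)))}] z,
          stableOrbitalIntegralRel (IsLocalStablyConjH L v) mHv fH γ = ∑ u ∈ S, classOrbitalIntegral mU fH u * Γ u γ))
    (hdual :
    ∀ (L : Type) [Field L] [NumberField L] [IsCMField L] (v : HeightOneSpectrum (𝓞 ↥(maximalRealSubfield L)))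
      [MeasurableSpace ((UnitaryGroup.cmDatum L 2 (Matrix.of fun i j : Fin 2 => if i.val + j.val + 1 = 2 then (1 : L) else 0)).Local v × (UnitaryGroup.cmDatum L 1 (Matrix.of fun i j : Fin 1 => if i.val + j.val + 1 = 1 then (1 : L) else 0)).Local v)] [BorelSpace ((UnitaryGroup.cmDatum L 2 (Matrix.of fun i j : Fin 2 => if i.val + j.val + 1 = 2 then (1 : L) else 0)).Local v × (UnitaryGroup.cmDatum L 1 (Matrix.of fun i j : Fin 1 => if i.val + j.val + 1 = 1 then (1 : L) else 0)).Local v)]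
      [∀ a : (UnitaryGroup.cmDatum L 2 (Matrix.of fun i j : Fin 2 => if i.val + j.val + 1 = 2 then (1 : L) else 0)).Local v × (UnitaryGroup.cmDatum L 1 (Matrix.of fun i j : Fin 1 => if i.val + j.val + 1 = 1 then (1 : L) else 0)).Local v,
        MeasurableSpace (((UnitaryGroup.cmDatum L 2 (Matrix.of fun i j : Fin 2 => if i.val + j.val + 1 = 2 then (1 : L) else 0)).Local v × (UnitaryGroup.cmDatum L 1 (Matrix.of fun i j : Fin 1 => if i.val + j.val + 1 = 1 then (1 : L) else 0)).Local v) ⧸ Subgroup.centralizer ({a} : Set ((UnitaryGroup.cmDatum L 2 (Matrix.of fun i j : Fin 2 => if i.val + j.val + 1 = 2 then (1 : L) else 0)).Local v × (UnitaryGroup.cmDatum L 1 (Matrix.of fun i j : Fin 1 => if i.val + j.val + 1 = 1 then (1 : L) else 0)).Local v)))]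
      [∀ a : (UnitaryGroup.cmDatum L 2 (Matrix.of fun i j : Fin 2 => if i.val + j.val + 1 = 2 then (1 : L) else 0)).Local v × (UnitaryGroup.cmDatum L 1 (Matrix.of fun i j : Fin 1 => if i.val + j.val + 1 = 1 then (1 : L) else 0)).Local v,
        BorelSpace (((UnitaryGroup.cmDatum L 2 (Matrix.of fun i j : Fin 2 => if i.val + j.val + 1 = 2 then (1 : L) else 0)).Local v × (UnitaryGroup.cmDatum L 1 (Matrix.of fun i j : Fin 1 => if i.val + j.val + 1 = 1 then (1 : L) else 0)).Local v) ⧸ Subgroup.centralizer ({a} : Set ((UnitaryGroup.cmDatum L 2 (Matrix.of fun i j : Fin 2 => if i.val + j.val + 1 = 2 then (1 : L) else 0)).Local v × (UnitaryGroup.cmDatum L 1 (Matrix.of fun i j : Fin 1 => if i.val + j.val + 1 = 1 then (1 : L) else 0)).Local v)))],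
      Subsingleton (UnitaryGroup.PlacesOver L v) →
    ∀ z : (UnitaryGroup.cmDatum L 2 (Matrix.of fun i j : Fin 2 => if i.val + j.val + 1 = 2 then (1 : L) else 0)).Local v × (UnitaryGroup.cmDatum L 1 (Matrix.of fun i j : Fin 1 => if i.val + j.val + 1 = 1 then (1 : L) else 0)).Local v, z ∈ Subgroup.center ((UnitaryGroup.cmDatum L 2 (Matrix.of fun i j : Fin 2 => if i.val + j.val + 1 = 2 then (1 : L) else 0)).Local v × (UnitaryGroup.cmDatum L 1 (Matrix.of fun i j : Fin 1 => if i.val + j.val + 1 = 1 then (1 : L) else 0)).Local v) →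
    ∀ (S : Finset (ConjClasses ((UnitaryGroup.cmDatum L 2 (Matrix.of fun i j : Fin 2 => if i.val + j.val + 1 = 2 then (1 : L) else 0)).Local v × (UnitaryGroup.cmDatum L 1 (Matrix.of fun i j : Fin 1 => if i.val + j.val + 1 = 1 then (1 : L) else 0)).Local v))) (mU : OrbitalMeasureFamily ((UnitaryGroup.cmDatum L 2 (Matrix.of fun i j : Fin 2 => if i.val + j.val + 1 = 2 then (1 : L) else 0)).Local v × (UnitaryGroup.cmDatum L 1 (Matrix.of fun i j : Fin 1 => if i.val + j.val + 1 = 1 then (1 : L) else 0)).Local v)),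
      (∀ u ∈ S, ((((Quotient.out u * z⁻¹).1).val : GL (Fin 2) (UnitaryGroup.LocalRing L v)).val - 1) ^ 2 = 0 ∧ (Quotient.out u * z⁻¹).2 = 1) →
      mU.IsAdmissibleOn (fun γ : (UnitaryGroup.cmDatum L 2 (Matrix.of fun i j : Fin 2 => if i.val + j.val + 1 = 2 then (1 : L) else 0)).Local v × (UnitaryGroup.cmDatum L 1 (Matrix.of fun i j : Fin 1 => if i.val + j.val + 1 = 1 then (1 : L) else 0)).Local v => ConjClasses.mk γ ∈ S) →
      (∀ u ∈ S, ∀ fH : (UnitaryGroup.cmDatum L 2 (Matrix.of fun i j : Fin 2 => if i.val + j.val + 1 = 2 then (1 : L) else 0)).Local v × (UnitaryGroup.cmDatum L 1 (Matrix.of fun i j : Fin 1 => if i.val + j.val + 1 = 1 then (1 : L) else 0)).Local v → ℂ, IsLocSmooth fH →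
        Integrable (descConj (Quotient.out u : (UnitaryGroup.cmDatum L 2 (Matrix.of fun i j : Fin 2 => if i.val + j.val + 1 = 2 then (1 : L) else 0)).Local v × (UnitaryGroup.cmDatum L 1 (Matrix.of fun i j : Fin 1 => if i.val + j.val + 1 = 1 then (1 : L) else 0)).Local v) (Subgroup.centralizer ({(Quotient.out u : (UnitaryGroup.cmDatum L 2 (Matrix.of fun i j : Fin 2 => if i.val + j.val + 1 = 2 then (1 : L) else 0)).Local v × (UnitaryGroup.cmDatum L 1 (Matrix.of fun i j : Fin 1 => if i.val + j.val + 1 = 1 then (1 : L) else 0)).Local v)} : Set ((UnitaryGroup.cmDatum L 2 (Matrix.of fun i j : Fin 2 => if i.val + j.val + 1 = 2 then (1 : L) else 0)).Local v × (UnitaryGroup.cmDatum L 1 (Matrix.of fun i j : Fin 1 => if i.val + j.val + 1 = 1 then (1 : L) else 0)).Local v)))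
          (fun _ hg => Subgroup.mem_centralizer_singleton_iff.1 hg) fH) (mU u)) →
    ∃ fd : ConjClasses ((UnitaryGroup.cmDatum L 2 (Matrix.of fun i j : Fin 2 => if i.val + j.val + 1 = 2 then (1 : L) else 0)).Local v × (UnitaryGroup.cmDatum L 1 (Matrix.of fun i j : Fin 1 => if i.val + j.val + 1 = 1 then (1 : L) else 0)).Local v) → ((UnitaryGroup.cmDatum L 2 (Matrix.of fun i j : Fin 2 => if i.val + j.val + 1 = 2 then (1 : L) else 0)).Local v × (UnitaryGroup.cmDatum L 1 (Matrix.of fun i j : Fin 1 => if i.val + j.val + 1 = 1 then (1 : L) else 0)).Local v) → ℂ,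
      (∀ u ∈ S, IsLocSmooth (fd u)) ∧ (∀ u ∈ S, classOrbitalIntegral mU (fd u) u = 1) ∧
      (∀ u ∈ S, ∀ u' ∈ S, u ≠ u' → classOrbitalIntegral mU (fd u') u = 0))
    (hΨ :
    ∀ (L : Type) [Field L] [NumberField L] [IsCMField L] (v : HeightOneSpectrum (𝓞 ↥(maximalRealSubfield L)))
      [MeasurableSpace ((UnitaryGroup.cmDatum L 2 (Matrix.of fun i j : Fin 2 => if i.val + j.val + 1 = 2 then (1 : L) else 0)).Local v × (UnitaryGroup.cmDatum L 1 (Matrix.of fun i j : Fin 1 => if i.val + j.val + 1 = 1 then (1 : L) else 0)).Local v)] [BorelSpace ((UnitaryGroup.cmDatum L 2 (Matrix.of fun i j : Fin 2 => if i.val + j.val + 1 = 2 then (1 : L) else 0)).Local v × (UnitaryGroup.cmDatum L 1 (Matrix.of fun i j : Fin 1 => if i.val + j.val + 1 = 1 then (1 : L) else 0)).Local v)]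
      [∀ a : (UnitaryGroup.cmDatum L 2 (Matrix.of fun i j : Fin 2 => if i.val + j.val + 1 = 2 then (1 : L) else 0)).Local v × (UnitaryGroup.cmDatum L 1 (Matrix.of fun i j : Fin 1 => if i.val + j.val + 1 = 1 then (1 : L) else 0)).Local v,
        MeasurableSpace (((UnitaryGroup.cmDatum L 2 (Matrix.of fun i j : Fin 2 => if i.val + j.val + 1 = 2 then (1 : L) else 0)).Local v × (UnitaryGroup.cmDatum L 1 (Matrix.of fun i j : Fin 1 => if i.val + j.val + 1 = 1 then (1 : L) else 0)).Local v) ⧸ Subgroup.centralizer ({a} : Set ((UnitaryGroup.cmDatum L 2 (Matrix.of fun i j : Fin 2 => if i.val + j.val + 1 = 2 then (1 : L) else 0)).Local v × (UnitaryGroup.cmDatum L 1 (Matrix.of fun i j : Fin 1 => if i.val + j.val + 1 = 1 then (1 : L) else 0)).Local v)))]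
      [∀ a : (UnitaryGroup.cmDatum L 2 (Matrix.of fun i j : Fin 2 => if i.val + j.val + 1 = 2 then (1 : L) else 0)).Local v × (UnitaryGroup.cmDatum L 1 (Matrix.of fun i j : Fin 1 => if i.val + j.val + 1 = 1 then (1 : L) else 0)).Local v,
        BorelSpace (((UnitaryGroup.cmDatum L 2 (Matrix.of fun i j : Fin 2 => if i.val + j.val + 1 = 2 then (1 : L) else 0)).Local v × (UnitaryGroup.cmDatum L 1 (Matrix.of fun i j : Fin 1 => if i.val + j.val + 1 = 1 then (1 : L) else 0)).Local v) ⧸ Subgroup.centralizer ({a} : Set ((UnitaryGroup.cmDatum L 2 (Matrix.of fun i j : Fin 2 => if i.val + j.val + 1 = 2 then (1 : L) else 0)).Local v × (UnitaryGroup.cmDatum L 1 (Matrix.of fun i j : Fin 1 => if i.val + j.val + 1 = 1 then (1 : L) else 0)).Local v)))],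
      Subsingleton (UnitaryGroup.PlacesOver L v) →
    ∀ z : (UnitaryGroup.cmDatum L 2 (Matrix.of fun i j : Fin 2 => if i.val + j.val + 1 = 2 then (1 : L) else 0)).Local v × (UnitaryGroup.cmDatum L 1 (Matrix.of fun i j : Fin 1 => if i.val + j.val + 1 = 1 then (1 : L) else 0)).Local v, z ∈ Subgroup.center ((UnitaryGroup.cmDatum L 2 (Matrix.of fun i j : Fin 2 => if i.val + j.val + 1 = 2 then (1 : L) else 0)).Local v × (UnitaryGroup.cmDatum L 1 (Matrix.of fun i j : Fin 1 => if i.val + j.val + 1 = 1 then (1 : L) else 0)).Local v) →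
    ∃ (Ψ : (UnitaryGroup.cmDatum L 2 (Matrix.of fun i j : Fin 2 => if i.val + j.val + 1 = 2 then (1 : L) else 0)).Local v × (UnitaryGroup.cmDatum L 1 (Matrix.of fun i j : Fin 1 => if i.val + j.val + 1 = 1 then (1 : L) else 0)).Local v → (UnitaryGroup.cmDatum L 2 (Matrix.of fun i j : Fin 2 => if i.val + j.val + 1 = 2 then (1 : L) else 0)).Local v × (UnitaryGroup.cmDatum L 1 (Matrix.of fun i j : Fin 1 => if i.val + j.val + 1 = 1 then (1 : L) else 0)).Local v) (U₀ : Set ((UnitaryGroup.cmDatum L 2 (Matrix.of fun i j : Fin 2 => if i.val + j.val + 1 = 2 then (1 : L) else 0)).Local v × (UnitaryGroup.cmDatum L 1 (Matrix.of fun i j : Fin 1 => if i.val + j.val + 1 = 1 then (1 : L) else 0)).Local v)) (q : ℂ) (a : ConjClasses ((UnitaryGroup.cmDatum L 2 (Matrix.of fun i j : Fin 2 => if i.val + j.val + 1 = 2 then (1 : L) else 0)).Local v × (UnitaryGroup.cmDatum L 1 (Matrix.of fun i j : Fin 1 => if i.val + j.val + 1 = 1 then (1 : L) else 0)).Local v)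 → ℕ) (γs : (UnitaryGroup.cmDatum L 2 (Matrix.of fun i j : Fin 2 => if i.val + j.val + 1 = 2 then (1 : L) else 0)).Local v × (UnitaryGroup.cmDatum L 1 (Matrix.of fun i j : Fin 1 => if i.val + j.val + 1 = 1 then (1 : L) else 0)).Local v),
      U₀ ∈ 𝓝 z ∧
      (∀ γ ∈ U₀, ∀ x : (UnitaryGroup.cmDatum L 2 (Matrix.of fun i j : Fin 2 => if i.val + j.val + 1 = 2 then (1 : L) else 0)).Local v × (UnitaryGroup.cmDatum L 1 (Matrix.of fun i j : Fin 1 => if i.val + j.val + 1 = 1 then (1 : L) else 0)).Local v, x * γ * x⁻¹ ∈ U₀) ∧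
      (∀ γ ∈ U₀, ∀ δ : (UnitaryGroup.cmDatum L 2 (Matrix.of fun i j : Fin 2 => if i.val + j.val + 1 = 2 then (1 : L) else 0)).Local v × (UnitaryGroup.cmDatum L 1 (Matrix.of fun i j : Fin 1 => if i.val + j.val + 1 = 1 then (1 : L) else 0)).Local v, IsLocalStablyConjH L v γ δ → δ ∈ U₀) ∧
      (∀ γ ∈ U₀, ∀ x : (UnitaryGroup.cmDatum L 2 (Matrix.of fun i j : Fin 2 => if i.val + j.val + 1 = 2 then (1 : L) else 0)).Local v × (UnitaryGroup.cmDatum L 1 (Matrix.of fun i j : Fin 1 => if i.val + j.val + 1 = 1 then (1 : L) else 0)).Local v, Ψ (x * γ * x⁻¹) = x * Ψ γ * x⁻¹) ∧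
      (∀ γ ∈ U₀, ∀ y : (UnitaryGroup.cmDatum L 2 (Matrix.of fun i j : Fin 2 => if i.val + j.val + 1 = 2 then (1 : L) else 0)).Local v × (UnitaryGroup.cmDatum L 1 (Matrix.of fun i j : Fin 1 => if i.val + j.val + 1 = 1 then (1 : L) else 0)).Local v, y * γ = γ * y ↔ y * Ψ γ = Ψ γ * y) ∧
      (∀ γ ∈ U₀, ∀ δ ∈ U₀, IsLocalStablyConjH L v γ δ → IsLocalStablyConjH L v (Ψ γ) (Ψ δ)) ∧
      (∀ γ ∈ U₀, ∀ δ ∈ U₀, Ψ γ = Ψ δ → γ = δ) ∧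
      (∀ γ ∈ U₀, ∀ η : (UnitaryGroup.cmDatum L 2 (Matrix.of fun i j : Fin 2 => if i.val + j.val + 1 = 2 then (1 : L) else 0)).Local v × (UnitaryGroup.cmDatum L 1 (Matrix.of fun i j : Fin 1 => if i.val + j.val + 1 = 1 then (1 : L) else 0)).Local v, IsLocalStablyConjH L v (Ψ γ) η → ∃ δ ∈ U₀, IsLocalStablyConjH L v γ δ ∧ Ψ δ = η) ∧
      (∀ γ ∈ U₀, Ψ γ ∈ U₀) ∧
      (∀ F : (UnitaryGroup.cmDatum L 2 (Matrix.of fun i j : Fin 2 => if i.val + j.val + 1 = 2 then (1 : L) else 0)).Local v × (UnitaryGroup.cmDatum L 1 (Matrix.of fun i j : Fin 1 => if i.val + j.val + 1 = 1 then (1 : L) else 0)).Local v → ℂ, IsLocSmooth F → IsLocSmooth (U₀.indicator (F ∘ Ψ))) ∧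
      1 < ‖q‖ ∧
      (∀ u : ConjClasses ((UnitaryGroup.cmDatum L 2 (Matrix.of fun i j : Fin 2 => if i.val + j.val + 1 = 2 then (1 : L) else 0)).Local v × (UnitaryGroup.cmDatum L 1 (Matrix.of fun i j : Fin 1 => if i.val + j.val + 1 = 1 then (1 : L) else 0)).Local v), u ≠ ConjClasses.mk z → 1 ≤ a u) ∧
      (γs ∈ U₀ ∧ (∀ k : ℕ, IsLocalGRegular L v (Ψ^[k] γs) ∧ CompactSpace (Subgroup.centralizer ({Ψ^[k] γs} : Set ((UnitaryGroup.cmDatum L 2 (Matrix.of fun i j : Fin 2 => if i.val + j.val + 1 = 2 then (1 : L) else 0)).Local v × (UnitaryGroup.cmDatum L 1 (Matrix.of fun i j : Fin 1 => if i.val + j.val + 1 = 1 then (1 : L) else 0)).Local v)))) ∧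
        Tendsto (fun k : ℕ => Ψ^[k] γs) atTop (𝓝 z)) ∧
      ∀ (S : Finset (ConjClasses ((UnitaryGroup.cmDatum L 2 (Matrix.of fun i j : Fin 2 => if i.val + j.val + 1 = 2 then (1 : L) else 0)).Local v × (UnitaryGroup.cmDatum L 1 (Matrix.of fun i j : Fin 1 => if i.val + j.val + 1 = 1 then (1 : L) else 0)).Local v))) (mU : OrbitalMeasureFamily ((UnitaryGroup.cmDatum L 2 (Matrix.of fun i j : Fin 2 => if i.val + j.val + 1 = 2 then (1 : L) else 0)).Local v × (UnitaryGroup.cmDatum L 1 (Matrix.of fun i j : Fin 1 => if i.val + j.val + 1 = 1 then (1 : L) else 0)).Local v)),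
        (∀ u ∈ S, ((((Quotient.out u * z⁻¹).1).val : GL (Fin 2) (UnitaryGroup.LocalRing L v)).val - 1) ^ 2 = 0 ∧ (Quotient.out u * z⁻¹).2 = 1) →
        mU.IsAdmissibleOn (fun γ : (UnitaryGroup.cmDatum L 2 (Matrix.of fun i j : Fin 2 => if i.val + j.val + 1 = 2 then (1 : L) else 0)).Local v × (UnitaryGroup.cmDatum L 1 (Matrix.of fun i j : Fin 1 => if i.val + j.val + 1 = 1 then (1 : L) else 0)).Local v => ConjClasses.mk γ ∈ S) →
        ∀ u ∈ S, ∀ F : (UnitaryGroup.cmDatum L 2 (Matrix.of fun i j : Fin 2 => if i.val + j.val + 1 = 2 then (1 : L) else 0)).Local v × (UnitaryGroup.cmDatum L 1 (Matrix.of fun i j : Fin 1 => if i.val + j.val + 1 = 1 then (1 : L) else 0)).Local v → ℂ, IsLocSmooth F →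
          classOrbitalIntegral mU (U₀.indicator (F ∘ Ψ)) u = q ^ (a u) * classOrbitalIntegral mU F u) :
    ∀ (L : Type) [Field L] [NumberField L] [IsCMField L] (H' : Matrix (Fin 3) (Fin 3) L),
      (H'.map (cmConjRingHom L)).transpose = H' →
      (∀ x : Fin 3 → L, hermForm (cmConjRingHom L) H' x x = 0 → x = 0) →
    ∀ (v : HeightOneSpectrum (𝓞 ↥(maximalRealSubfield L)))
      [MeasurableSpace ((UnitaryGroup.cmDatum L 2 (Matrix.of fun i j : Fin 2 => if i.val + j.val + 1 = 2 then (1 : L) else 0)).Local v × (UnitaryGroup.cmDatum L 1 (Matrix.of fun i j : Fin 1 => if i.val + j.val + 1 = 1 then (1 : L) else 0)).Local v)] [BorelSpace ((UnitaryGroup.cmDatum L 2 (Matrix.of fun i j : Fin 2 => if i.val + j.val + 1 = 2 then (1 : L) else 0)).Local v × (UnitaryGroup.cmDatum L 1 (Matrix.of fun i j : Fin 1 => if i.val + j.val + 1 = 1 then (1 : L) else 0)).Local v)]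
      [∀ a : (UnitaryGroup.cmDatum L 2 (Matrix.of fun i j : Fin 2 => if i.val + j.val + 1 = 2 then (1 : L) else 0)).Local v × (UnitaryGroup.cmDatum L 1 (Matrix.of fun i j : Fin 1 => if i.val + j.val + 1 = 1 then (1 : L) else 0)).Local v,
        MeasurableSpace (((UnitaryGroup.cmDatum L 2 (Matrix.of fun i j : Fin 2 => if i.val + j.val + 1 = 2 then (1 : L) else 0)).Local v × (UnitaryGroup.cmDatum L 1 (Matrix.of fun i j : Fin 1 => if i.val + j.val + 1 = 1 then (1 : L) else 0)).Local v) ⧸ Subgroup.centralizer ({a} : Set ((UnitaryGroup.cmDatum L 2 (Matrix.of fun i j : Fin 2 => if i.val + j.val + 1 = 2 then (1 : L) else 0)).Local v × (UnitaryGroup.cmDatum L 1 (Matrix.of fun i j : Fin 1 => if i.val + j.val + 1 = 1 then (1 : L) else 0)).Local v)))]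
      [∀ a : (UnitaryGroup.cmDatum L 2 (Matrix.of fun i j : Fin 2 => if i.val + j.val + 1 = 2 then (1 : L) else 0)).Local v × (UnitaryGroup.cmDatum L 1 (Matrix.of fun i j : Fin 1 => if i.val + j.val + 1 = 1 then (1 : L) else 0)).Local v,
        BorelSpace (((UnitaryGroup.cmDatum L 2 (Matrix.of fun i j : Fin 2 => if i.val + j.val + 1 = 2 then (1 : L) else 0)).Local v × (UnitaryGroup.cmDatum L 1 (Matrix.of fun i j : Fin 1 => if i.val + j.val + 1 = 1 then (1 : L) else 0)).Local v) ⧸ Subgroup.centralizer ({a} : Set ((UnitaryGroup.cmDatum L 2 (Matrix.of fun i j : Fin 2 => if i.val + j.val + 1 = 2 then (1 : L) else 0)).Local v × (UnitaryGroup.cmDatum L 1 (Matrix.of fun i j : Fin 1 => if i.val + j.val + 1 = 1 then (1 : L) else 0)).Local v)))]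
      [MeasurableSpace ((UnitaryGroup.cmDatum L 3 H').Local v)] [BorelSpace ((UnitaryGroup.cmDatum L 3 H').Local v)]
      [∀ γ : (UnitaryGroup.cmDatum L 3 H').Local v, MeasurableSpace ((UnitaryGroup.cmDatum L 3 H').Local v ⧸ Subgroup.centralizer ({γ} : Set ((UnitaryGroup.cmDatum L 3 H').Local v)))]
      [∀ γ : (UnitaryGroup.cmDatum L 3 H').Local v, BorelSpace ((UnitaryGroup.cmDatum L 3 H').Local v ⧸ Subgroup.centralizer ({γ} : Set ((UnitaryGroup.cmDatum L 3 H').Local v)))]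
      (νHv : Measure ((UnitaryGroup.cmDatum L 2 (Matrix.of fun i j : Fin 2 => if i.val + j.val + 1 = 2 then (1 : L) else 0)).Local v × (UnitaryGroup.cmDatum L 1 (Matrix.of fun i j : Fin 1 => if i.val + j.val + 1 = 1 then (1 : L) else 0)).Local v)) (νGv : Measure ((UnitaryGroup.cmDatum L 3 H').Local v))
      [IsFiniteMeasureOnCompacts νHv] [νHv.IsMulRightInvariant] [νGv.IsHaarMeasure] [νGv.IsMulRightInvariant]
      (Δv : LocalTransferFactor L H' v)
      (mHv : OrbitalMeasureFamily ((UnitaryGroup.cmDatum L 2 (Matrix.of fun i j : Fin 2 => if i.val + j.val + 1 = 2 then (1 : L) else 0)).Local v × (UnitaryGroup.cmDatum L 1 (Matrix.of fun i j : Fin 1 => if i.val + j.val + 1 = 1 then (1 : L) else 0)).Local v)) (mGv : OrbitalMeasureFamily ((UnitaryGroup.cmDatum L 3 H').Local v)),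
      IsLocalTransferDatum L H' v Δv mHv mGv →
      mHv.IsCanonical (IsLocalGRegular L v) νHv →
      mGv.IsCanonical (fun γ : (UnitaryGroup.cmDatum L 3 H').Local v => IsRegularElt (γ.val : GL (Fin 3) (UnitaryGroup.LocalRing L v))) νGv →
      Subsingleton (UnitaryGroup.PlacesOver L v) →
    ∀ z : (UnitaryGroup.cmDatum L 2 (Matrix.of fun i j : Fin 2 => if i.val + j.val + 1 = 2 then (1 : L) else 0)).Local v × (UnitaryGroup.cmDatum L 1 (Matrix.of fun i j : Fin 1 => if i.val + j.val + 1 = 1 then (1 : L) else 0)).Local v, z ∈ Subgroup.center ((UnitaryGroup.cmDatum L 2 (Matrix.of fun i j : Fin 2 => if i.val + j.val + 1 = 2 then (1 : L) else 0)).Local v × (UnitaryGroup.cmDatum L 1 (Matrix.of fun i j : Fin 1 => if i.val + j.val + 1 = 1 then (1 : L) else 0)).Local v) →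
    ∃ (S : Finset (ConjClasses ((UnitaryGroup.cmDatum L 2 (Matrix.of fun i j : Fin 2 => if i.val + j.val + 1 = 2 then (1 : L) else 0)).Local v × (UnitaryGroup.cmDatum L 1 (Matrix.of fun i j : Fin 1 => if i.val + j.val + 1 = 1 then (1 : L) else 0)).Local v))) (mU : OrbitalMeasureFamily ((UnitaryGroup.cmDatum L 2 (Matrix.of fun i j : Fin 2 => if i.val + j.val + 1 = 2 then (1 : L) else 0)).Local v × (UnitaryGroup.cmDatum L 1 (Matrix.of fun i j : Fin 1 => if i.val + j.val + 1 = 1 then (1 : L) else 0)).Local v))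
      (Γ : ConjClasses ((UnitaryGroup.cmDatum L 2 (Matrix.of fun i j : Fin 2 => if i.val + j.val + 1 = 2 then (1 : L) else 0)).Local v × (UnitaryGroup.cmDatum L 1 (Matrix.of fun i j : Fin 1 => if i.val + j.val + 1 = 1 then (1 : L) else 0)).Local v) → (UnitaryGroup.cmDatum L 2 (Matrix.of fun i j : Fin 2 => if i.val + j.val + 1 = 2 then (1 : L) else 0)).Local v × (UnitaryGroup.cmDatum L 1 (Matrix.of fun i j : Fin 1 => if i.val + j.val + 1 = 1 then (1 : L) else 0)).Local v → ℂ)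
      (γseq : ℕ → (UnitaryGroup.cmDatum L 2 (Matrix.of fun i j : Fin 2 => if i.val + j.val + 1 = 2 then (1 : L) else 0)).Local v × (UnitaryGroup.cmDatum L 1 (Matrix.of fun i j : Fin 1 => if i.val + j.val + 1 = 1 then (1 : L) else 0)).Local v) (q : ℂ) (a : ConjClasses ((UnitaryGroup.cmDatum L 2 (Matrix.of fun i j : Fin 2 => if i.val + j.val + 1 = 2 then (1 : L) else 0)).Local v × (UnitaryGroup.cmDatum L 1 (Matrix.of fun i j : Fin 1 => if i.val + j.val + 1 = 1 then (1 : L) else 0)).Local v) → ℕ) (g : ConjClasses ((UnitaryGroup.cmDatum L 2 (Matrix.of fun i j : Fin 2 => if i.val + j.val + 1 = 2 then (1 : L) else 0)).Local v × (UnitaryGroup.cmDatum L 1 (Matrix.of fun i j : Fin 1 => if i.val + j.val + 1 = 1 then (1 : L) else 0)).Local v) → ℂ) (n₀ : ℕ),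
      ConjClasses.mk z ∈ S ∧
      (∀ u ∈ S, ((((Quotient.out u * z⁻¹).1).val : GL (Fin 2) (UnitaryGroup.LocalRing L v)).val - 1) ^ 2 = 0 ∧ (Quotient.out u * z⁻¹).2 = 1) ∧
      mU.IsAdmissibleOn (fun γ : (UnitaryGroup.cmDatum L 2 (Matrix.of fun i j : Fin 2 => if i.val + j.val + 1 = 2 then (1 : L) else 0)).Local v × (UnitaryGroup.cmDatum L 1 (Matrix.of fun i j : Fin 1 => if i.val + j.val + 1 = 1 then (1 : L) else 0)).Local v => ConjClasses.mk γ ∈ S) ∧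
      (∀ u ∈ S, ∀ fH : (UnitaryGroup.cmDatum L 2 (Matrix.of fun i j : Fin 2 => if i.val + j.val + 1 = 2 then (1 : L) else 0)).Local v × (UnitaryGroup.cmDatum L 1 (Matrix.of fun i j : Fin 1 => if i.val + j.val + 1 = 1 then (1 : L) else 0)).Local v → ℂ, IsLocSmooth fH →
        Integrable (descConj (Quotient.out u : (UnitaryGroup.cmDatum L 2 (Matrix.of fun i j : Fin 2 => if i.val + j.val + 1 = 2 then (1 : L) else 0)).Local v × (UnitaryGroup.cmDatum L 1 (Matrix.of fun i j : Fin 1 => if i.val + j.val + 1 = 1 then (1 : L) else 0)).Local v) (Subgroup.centralizer ({(Quotient.out u : (UnitaryGroup.cmDatum L 2 (Matrix.of fun i j : Fin 2 => if i.val + j.val + 1 = 2 then (1 : L) else 0)).Local v × (UnitaryGroup.cmDatum L 1 (Matrix.of fun i j : Fin 1 => if i.val + j.val + 1 = 1 then (1 : L) else 0)).Local v)} : Set ((UnitaryGroup.cmDatum L 2 (Matrix.of fun i j : Fin 2 => if i.val + j.val + 1 = 2 then (1 : L) else 0)).Local v × (UnitaryGroup.cmDatum L 1 (Matrix.of fun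 i j : Fin 1 => if i.val + j.val + 1 = 1 then (1 : L) else 0)).Local v)))
          (fun _ hg => Subgroup.mem_centralizer_singleton_iff.1 hg) fH) (mU u)) ∧
      (∀ fH : (UnitaryGroup.cmDatum L 2 (Matrix.of fun i j : Fin 2 => if i.val + j.val + 1 = 2 then (1 : L) else 0)).Local v × (UnitaryGroup.cmDatum L 1 (Matrix.of fun i j : Fin 1 => if i.val + j.val + 1 = 1 then (1 : L) else 0)).Local v → ℂ, IsLocSmooth fH → ∀ᶠ γ in 𝓝[{γ : (UnitaryGroup.cmDatum L 2 (Matrix.of fun i j : Fin 2 => if i.val + j.val + 1 = 2 then (1 : L) else 0)).Local v × (UnitaryGroup.cmDatum L 1 (Matrix.of fun i j : Fin 1 => if i.val + j.val + 1 = 1 then (1 : L) else 0)).Local v |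
            IsLocalGRegular L v γ ∧ CompactSpace (Subgroup.centralizer ({γ} : Set ((UnitaryGroup.cmDatum L 2 (Matrix.of fun i j : Fin 2 => if i.val + j.val + 1 = 2 then (1 : L) else 0)).Local v × (UnitaryGroup.cmDatum L 1 (Matrix.of fun i j : Fin 1 => if i.val + j.val + 1 = 1 then (1 : L) else 0)).Local v)))}] z,
          stableOrbitalIntegralRel (IsLocalStablyConjH L v) mHv fH γ = ∑ u ∈ S, classOrbitalIntegral mU fH u * Γ u γ) ∧
      (∀ n, IsLocalGRegular L v (γseq n) ∧ CompactSpace (Subgroup.centralizer ({γseq n} : Set ((UnitaryGroup.cmDatum L 2 (Matrix.of fun i j : Fin 2 => if i.val + j.val + 1 = 2 then (1 : L) else 0)).Local v × (UnitaryGroup.cmDatum L 1 (Matrix.of fun i j : Fin 1 => if i.val + j.val + 1 = 1 then (1 : L) else 0)).Local v)))) ∧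
      Tendsto γseq atTop (𝓝 z) ∧ 1 < ‖q‖ ∧
      (∀ u ∈ S, u ≠ ConjClasses.mk z → 1 ≤ a u) ∧
      ∀ u ∈ S, u ≠ ConjClasses.mk z → ∀ n, n₀ ≤ n → Γ u (γseq n) = q ^ (n * a u) * g u := by
  intro L _ _ _ H' hH' hH'a v _ _ _ _ _ _ _ _ νHv νGv _ _ _ _ Δv mHv mGv hLTD hcanH hcanG hns z hz
  classical
  -- the (E)-datum, its dual pieces, the package
  obtain ⟨S, mU, Γ, hzS, hunip, hadm, hint, hexp⟩ := hExp L H' hH' hH'a v νHv νGv Δv mHv mGv hLTD hcanH hcanG hns z hz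
  obtain ⟨φ, hφs, hφ1, hφ0⟩ := hdual L v hns z hz S mU hunip hadm hint
  obtain ⟨Ψ, U₀, q, a, γs, -, hU2, hU2st, hEq, hZ, hEst, hI, hSst, hC, hS, hq, ha, ⟨hγsU, hreg, hlim⟩, hSC⟩ := hΨ L v hns z hz
  -- (A) the expansion collapses at the dual pieces
  have hWφ : ∀ u ∈ S, ∀ᶠ γ in 𝓝[{γ : (UnitaryGroup.cmDatum L 2 (Matrix.of fun i j : Fin 2 => if i.val + j.val + 1 = 2 then (1 : L) else 0)).Local v × (UnitaryGroup.cmDatum L 1 (Matrix.of fun i j : Fin 1 => if i.val + j.val + 1 = 1 then (1 : L) else 0)).Local v |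
            IsLocalGRegular L v γ ∧ CompactSpace (Subgroup.centralizer ({γ} : Set ((UnitaryGroup.cmDatum L 2 (Matrix.of fun i j : Fin 2 => if i.val + j.val + 1 = 2 then (1 : L) else 0)).Local v × (UnitaryGroup.cmDatum L 1 (Matrix.of fun i j : Fin 1 => if i.val + j.val + 1 = 1 then (1 : L) else 0)).Local v)))}] z,
      stableOrbitalIntegralRel (IsLocalStablyConjH L v) mHv (φ u) γ = Γ u γ := by
    intro u hu
    filter_upwards [hexp (φ u) (hφs u hu)] with γ hγ
    rw [hγ]
    exact sum_mul_eq_single_of_dual S (fun u' => classOrbitalIntegral mU (φ u) u') (fun u' => Γ u' γ) hu (hφ1 u hu)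
      (fun u' hu' hne => hφ0 u' hu' u hu hne)
  -- (B) … and at the pulled-back dual pieces, through (SC)
  have hWψ : ∀ u ∈ S, ∀ᶠ γ in 𝓝[{γ : (UnitaryGroup.cmDatum L 2 (Matrix.of fun i j : Fin 2 => if i.val + j.val + 1 = 2 then (1 : L) else 0)).Local v × (UnitaryGroup.cmDatum L 1 (Matrix.of fun i j : Fin 1 => if i.val + j.val + 1 = 1 then (1 : L) else 0)).Local v |
            IsLocalGRegular L v γ ∧ CompactSpace (Subgroup.centralizer ({γ} : Set ((UnitaryGroup.cmDatum L 2 (Matrix.of fun i j : Fin 2 => if i.val + j.val + 1 = 2 then (1 : L) else 0)).Local v × (UnitaryGroup.cmDatum L 1 (Matrix.of fun i j : Fin 1 => if i.val + j.val + 1 = 1 then (1 : L) else 0)).Local v)))}] z,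
      stableOrbitalIntegralRel (IsLocalStablyConjH L v) mHv (U₀.indicator (φ u ∘ Ψ)) γ = q ^ (a u) * Γ u γ := by
    intro u hu
    filter_upwards [hexp (U₀.indicator (φ u ∘ Ψ)) (hS (φ u) (hφs u hu))] with γ hγ
    rw [hγ]
    have hrow : ∀ u' ∈ S, classOrbitalIntegral mU (U₀.indicator (φ u ∘ Ψ)) u' = q ^ (a u') * classOrbitalIntegral mU (φ u) u' :=
      fun u' hu' => hSC S mU hunip hadm u' hu' (φ u) (hφs u hu)
    rw [Finset.sum_congr rfl (fun u' hu' => by rw [hrow u' hu'])]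
    rw [Finset.sum_eq_single_of_mem u hu (fun u' hu' hne => by rw [hφ0 u' hu' u hu hne, mul_zero, zero_mul]), hφ1 u hu, mul_one]
  -- (C) the local homogeneity at a point of `U₀` where (B) holds and (A) holds at its image
  have hloc : ∀ γ ∈ U₀, IsLocalGRegular L v γ → IsLocalGRegular L v (Ψ γ) →
      (∀ u ∈ S, stableOrbitalIntegralRel (IsLocalStablyConjH L v) mHv (U₀.indicator (φ u ∘ Ψ)) γ = q ^ (a u) * Γ u γ) →
      (∀ u ∈ S, stableOrbitalIntegralRel (IsLocalStablyConjH L v) mHv (φ u) (Ψ γ) = Γ u (Ψ γ)) →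
        ∀ u ∈ S, Γ u (Ψ γ) = q ^ (a u) * Γ u γ := by
    intro γ hγU hγ hΨγ hψ hφ' u hu
    rw [← hφ' u hu, stableOrbitalIntegralRel_eq_of_contraction L v νHv hcanH hU2 hU2st hEq hZ hEst hI hSst hγU hγ hΨγ (φ u), hψ u hu]
  -- (D) the ray: iterates stay in `U₀`, tend to `z` inside the elliptic `G`-regular set, and are deep enough from `k₀` on
  have hitU : ∀ k, Ψ^[k] γs ∈ U₀ := fun k => iterate_mem hC hγsU k
  have hlimW : Tendsto (fun k : ℕ => Ψ^[k] γs) atTop (𝓝[{γ : (UnitaryGroup.cmDatum L 2 (Matrix.of fun i j : Fin 2 => if i.val + j.val + 1 = 2 then (1 : L) else 0)).Local v × (UnitaryGroup.cmDatum L 1 (Matrix.of fun i j : Fin 1 => if i.val + j.val + 1 = 1 then (1 : L) else 0)).Local v |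
            IsLocalGRegular L v γ ∧ CompactSpace (Subgroup.centralizer ({γ} : Set ((UnitaryGroup.cmDatum L 2 (Matrix.of fun i j : Fin 2 => if i.val + j.val + 1 = 2 then (1 : L) else 0)).Local v × (UnitaryGroup.cmDatum L 1 (Matrix.of fun i j : Fin 1 => if i.val + j.val + 1 = 1 then (1 : L) else 0)).Local v)))}] z) :=
    tendsto_nhdsWithin_iff.2 ⟨hlim, Eventually.of_forall fun k => hreg k⟩
  have hlimW' : Tendsto (fun k : ℕ => Ψ^[k + 1] γs) atTop (𝓝[{γ : (UnitaryGroup.cmDatum L 2 (Matrix.of fun i j : Fin 2 => if i.val + j.val + 1 = 2 then (1 : L) else 0)).Local v × (UnitaryGroup.cmDatum L 1 (Matrix.of fun i j : Fin 1 => if i.val + j.val + 1 = 1 then (1 : L) else 0)).Local v |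
            IsLocalGRegular L v γ ∧ CompactSpace (Subgroup.centralizer ({γ} : Set ((UnitaryGroup.cmDatum L 2 (Matrix.of fun i j : Fin 2 => if i.val + j.val + 1 = 2 then (1 : L) else 0)).Local v × (UnitaryGroup.cmDatum L 1 (Matrix.of fun i j : Fin 1 => if i.val + j.val + 1 = 1 then (1 : L) else 0)).Local v)))}] z) :=
    hlimW.comp (tendsto_add_atTop_nat 1)
  have hev : ∀ᶠ k in atTop,
      (∀ u ∈ S, stableOrbitalIntegralRel (IsLocalStablyConjH L v) mHv (U₀.indicator (φ u ∘ Ψ)) (Ψ^[k] γs) = q ^ (a u) * Γ u (Ψ^[k] γs)) ∧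
      (∀ u ∈ S, stableOrbitalIntegralRel (IsLocalStablyConjH L v) mHv (φ u) (Ψ^[k + 1] γs) = Γ u (Ψ^[k + 1] γs)) := by
    refine Filter.Eventually.and ?_ ?_
    · rw [eventually_all_finset]
      intro u hu
      exact hlimW.eventually (hWψ u hu)
    · rw [eventually_all_finset]
      intro u hu
      exact hlimW'.eventually (hWφ u hu)
  obtain ⟨k₀, hk₀⟩ := eventually_atTop.1 hev
  -- the data of (HOM-ray*)
  refine ⟨S, mU, Γ, fun n => Ψ^[n + k₀] γs, q, a, fun u => Γ u (Ψ^[k₀] γs), 0, hzS, hunip, hadm, hint, hexp,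
    fun n => hreg (n + k₀), hlim.comp (tendsto_add_atTop_nat k₀), hq, fun u _ hne => ha u hne, fun u hu _ n _ => ?_⟩
  -- HOM along the ray: the geometric recursion
  have hstep : ∀ k, Γ u (Ψ^[(k + 1) + k₀] γs) = q ^ (a u) * Γ u (Ψ^[k + k₀] γs) := by
    intro k
    have e : Ψ^[(k + 1) + k₀] γs = Ψ (Ψ^[k + k₀] γs) := by
      rw [show (k + 1) + k₀ = (k + k₀) + 1 by ring, Function.iterate_succ_apply']
    rw [e]
    have hk := hk₀ (k + k₀) (Nat.le_add_left k₀ k)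
    have hφ' : ∀ u' ∈ S, stableOrbitalIntegralRel (IsLocalStablyConjH L v) mHv (φ u') (Ψ (Ψ^[k + k₀] γs)) = Γ u' (Ψ (Ψ^[k + k₀] γs)) := by
      intro u' hu'
      have h' := hk.2 u' hu'
      rwa [Function.iterate_succ_apply'] at h'
    have hΨreg : IsLocalGRegular L v (Ψ (Ψ^[k + k₀] γs)) := by
      have h' := (hreg (k + k₀ + 1)).1
      rwa [Function.iterate_succ_apply'] at h'
    exact hloc _ (hitU _) (hreg (k + k₀)).1 hΨreg hk.1 hφ' u hu
  have := eq_pow_mul_of_succ_eq_mul (s := fun k => Γ u (Ψ^[k + k₀] γs)) (r := q ^ (a u)) hstep n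
  simp only [zero_add] at this
  rw [this, ← pow_mul, mul_comm (a u) n]

end Summit.HodgeConjecture.HodgeConjecture.Cruxes.H413.K2E3CentralGermHomogeneityRayRefOfUnipotentScaling

end
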